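import Literature.NumberTheory.EllipticCurves.KrizLi2019.EisensteinHeegnerLog
import Mathlib.NumberTheory.LegendreSymbol.Basic
import HarnessLib

/-!
# O11 at `p = 7`, ROUTE U — T-U4 ψ-layer for `D = −11`: the Eisenstein character `ψ = χ_{−11}·ω²`
# as a `ℚ₇`-valued Dirichlet character mod `77`, its conductor, its zeros, its values, and the two
# Bernoulli characters of Kriz–Li Thm. 1.20 identified with the certified `θ₁`, `θ₂`

HONEST FRAMING (cell `bsd-cm`, run/shared/lean/pub/bsd-cm/, verbatim): the programme isolates, for
CM elliptic curves over `ℚ` of analytic rank `≤ 1`, classes on which the FULL BSD formula is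
reduced — strictly by PUBLISHED theorems entering as named-fact binders — to ONE local problem at
ONE prime, and then TYPES that residual problem. Seat `bsd-cm-ram` (generation 3), planner T-U4
(«D = −11»). THEOREMS ONLY; nothing asserted about any curve.

For `E_{−11} = 49a1^{(−11)} = 5929e1` the Eisenstein data of Kriz–Li Thm. 1.20 at `p = 7` are
`ψ = χ_{−11}ω²` (conductor `f = 77`), `ω` Teichmüller, `ε_{K''} = χ_{−19}` (`K'' = ℚ(√−19)`).
Given ANY `ω` mod `7` with `IsTeichmullerCharacter ω`, ANY `χ` mod `11` with Legendre values and
ANY `ε` mod `19` with Legendre values, put `ψ := χ↑ · (ω²)↑` at level `77`. This file proves: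
* `conductor_mul_eq_mul_of_coprime` — conductors of characters with COPRIME conductors multiply
  (Mathlib has only `conductor_mul_dvd_lcm_conductor`); `conductor_eq_of_prime_of_ne_one`;
* `psiD11_apply` — `ψ(j) = (j/11)·ω(j)²` for all `j`; `psiD11_isPrimitive` (conductor `77`);
  `psiD11_apply_seven` (`ψ(7) = 0`, hypothesis (1a)); `psiD11_odd`;
* `psiD11_traceIdentity` — `ψ(ℓ) + ψ⁻¹(ℓ)ω(ℓ) = (ℓ/11)(ω(ℓ)² + ω(ℓ)⁵)` for `ℓ ∤ 77`: the input
  `hψ` of `RouteUTraceForm.hss_twist_cm7` (`J(ℓ | 11) = (ℓ/11)` for prime `ℓ`);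
* `bernoulliCharOne_psiD11` / `bernoulliCharTwo_psiD11` — `bernoulliCharOne ψ ε = (ψ⁻¹)↑`,
  `bernoulliCharTwo ψ ε ω = θ₂↑` with `θ₂ := ψ↑·ε↑·(ω⁻¹)↑` at level `1463`, and the VALUES
  `ψ⁻¹(j) = (j/11)ω(j)⁴`, `θ₂(j) = (j/11)(j/19)ω(j)` plus primitivity — exactly the hypotheses of
  `RouteUBernoulliD11.norm_generalizedBernoulli_theta{1,2}_D11` and of
  `RouteUBernoulliCertificate.bernoulli_hypothesis_of_certs`.
The three-line assembly `hB` for `D = −11` is filed once those two modules have oleans.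
References: [KrizLi2019] Thm. 1.20, §1.5, §2; [Washington1997] §3 (conductors), §5.1.
-/

noncomputable section

open scoped Classical
open DirichletCharacter Literature.NumberTheory.EllipticCurves.KrizLi2019

namespace Summit.BirchSwinnertonDyer.Rank1Residual.X12.O11.RouteU

/-! ## §1 Conductors -/

/-- **Characters with coprime conductors: `f(χψ) = f(χ)·f(ψ)`.** (`≤`: Mathlib's
`conductor_mul_dvd_lcm_conductor`; `≥`: `χ = (χψ)ψ⁻¹` gives `f(χ) ∣ lcm(f(χψ), f(ψ))`, and
coprimality.) [cite: Washington1997, Ch. 3 (conductor of a product of characters of coprime conductor)] -/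
theorem conductor_mul_eq_mul_of_coprime {R : Type*} [CommRing R] [IsDomain R] {n : ℕ} [NeZero n]
    (χ ψ : DirichletCharacter R n) (h : χ.conductor.Coprime ψ.conductor) :
    (χ * ψ).conductor = χ.conductor * ψ.conductor := by
  apply Nat.dvd_antisymm
  · have := conductor_mul_dvd_lcm_conductor χ ψ
    rwa [h.lcm_eq_mul] at this
  · have hχ : χ.conductor ∣ (χ * ψ).conductor := by
      have h1 : χ = (χ * ψ) * ψ⁻¹ := by rw [mul_assoc, mul_inv_cancel, mul_one]
      have h2 := conductor_mul_dvd_lcm_conductor (χ * ψ) ψ⁻¹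
      rw [← h1, conductor_inv] at h2
      have h3 : χ.conductor ∣ (χ * ψ).conductor * ψ.conductor :=
        h2.trans (Nat.lcm_dvd_mul _ _)
      exact h.dvd_of_dvd_mul_right h3
    have hψ : ψ.conductor ∣ (χ * ψ).conductor := by
      have h1 : ψ = (χ * ψ) * χ⁻¹ := by rw [mul_comm χ ψ, mul_assoc, mul_inv_cancel, mul_one]
      have h2 := conductor_mul_dvd_lcm_conductor (χ * ψ) χ⁻¹
      rw [← h1, conductor_inv] at h2
      have h3 : ψ.conductor ∣ (χ * ψ).conductor * χ.conductor :=
        h2.trans (Nat.lcm_dvd_mul _ _)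
      exact h.symm.dvd_of_dvd_mul_right h3
    exact h.mul_dvd_of_dvd_of_dvd hχ hψ

/-- A non-trivial character modulo a prime `q` is primitive: its conductor is `q`. [cite: Washington1997, Ch. 3 (conductor)] -/
theorem conductor_eq_of_prime_of_ne_one {R : Type*} [CommMonoidWithZero R] {q : ℕ} [Fact q.Prime]
    (χ : DirichletCharacter R q) (hχ : χ ≠ 1) : χ.conductor = q := by
  have hd : χ.conductor ∣ q := conductor_dvd_level χ
  rcases (Nat.dvd_prime Fact.out).mp hd with h | h
  · exact absurd (eq_one_iff_conductor_eq_one.mpr h) hχ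
  · exact h

/-- The conductor of a lift is the conductor (Mathlib `conductor_changeLevel`), in the form used
below: a product of lifts of characters with coprime conductors has conductor the product. [folklore] -/
theorem conductor_changeLevel_mul_changeLevel {R : Type*} [CommRing R] [IsDomain R] {a b n : ℕ}
    [NeZero n] (ha : a ∣ n) (hb : b ∣ n) (χ : DirichletCharacter R a) (ψ : DirichletCharacter R b)
    (h : χ.conductor.Coprime ψ.conductor) :
    (changeLevel ha χ * changeLevel hb ψ).conductor = χ.conductor * ψ.conductor := by
  haveI : NeZero a := ⟨fun h0 => by subst h0; exact (NeZero.ne n) (Nat.eq_zero_of_zero_dvd ha)⟩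
  haveI : NeZero b := ⟨fun h0 => by subst h0; exact (NeZero.ne n) (Nat.eq_zero_of_zero_dvd hb)⟩
  rw [conductor_mul_eq_mul_of_coprime _ _ (by rwa [conductor_changeLevel, conductor_changeLevel]),
    conductor_changeLevel, conductor_changeLevel]

/-! ## §2 `ψ = χ_{−11}·ω²` at level `77` -/

/-- `7`, `11`, `19` are prime (global instances: `decide` below needs them global). [folklore] -/
instance fact_prime_seven_psi : Fact (Nat.Prime 7) := ⟨by norm_num⟩

/-- `11` is prime. [folklore] -/
instance fact_prime_eleven_psi : Fact (Nat.Prime 11) := ⟨by norm_num⟩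

/-- `19` is prime. [folklore] -/
instance fact_prime_nineteen_psi : Fact (Nat.Prime 19) := ⟨by norm_num⟩

section Psi

variable (ω : DirichletCharacter ℚ_[7] 7) (χ : DirichletCharacter ℚ_[7] 11)

/-- A Teichmüller character is non-trivial, indeed `ω(3)² = ω(2) ≠ 1` (`ω(2) ≡ 2 (mod 7)`), so
`ω²` is non-trivial and `ω`, `ω²`, `ω⁻¹` all have conductor `7`. [cite: Washington1997, §5.1] -/
theorem teichmuller_sq_ne_one (hω : IsTeichmullerCharacter ω) : ω ^ 2 ≠ 1 := by
  intro h
  have h3 : (ω ^ 2) (3 : ZMod 7) = 1 := by rw [h, MulChar.one_apply (by decide)]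
  rw [MulChar.pow_apply' _ two_ne_zero, sq, ← map_mul, show (3 : ZMod 7) * 3 = ((2 : ℤ) : ZMod 7) by decide]
    at h3
  have hT := hω 2 (by decide)
  rw [h3] at hT
  have : ‖(1 : ℚ_[7]) - ((2 : ℤ) : ℚ_[7])‖ = 1 := by
    rw [show (1 : ℚ_[7]) - ((2 : ℤ) : ℚ_[7]) = -((1 : ℕ) : ℚ_[7]) by norm_num, norm_neg]
    exact Padic.norm_natCast_eq_one_iff.mpr (by decide)
  rw [this] at hT
  exact lt_irrefl _ hT

/-- `ω⁻¹ ≠ 1`. [cite: Washington1997, §5.1] -/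
theorem teichmuller_inv_ne_one (hω : IsTeichmullerCharacter ω) : ω⁻¹ ≠ 1 := by
  intro h
  have h1 : ω = 1 := inv_eq_one.mp h
  apply teichmuller_sq_ne_one ω hω
  rw [h1, one_pow]

/-- The Legendre character mod `11` is non-trivial (`(2/11) = −1`). [folklore] -/
theorem legendre11_ne_one (hχ : ∀ a : ℕ, χ (a : ZMod 11) = (legendreSym 11 (a : ℤ) : ℚ_[7])) :
    χ ≠ 1 := by
  intro h
  have h2 := hχ 2
  rw [h, MulChar.one_apply (by decide)] at h2
  have hL : legendreSym 11 ((2 : ℕ) : ℤ) = -1 := by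
    have := legendreSym.eq_pow 11 ((2 : ℕ) : ℤ)
    rcases legendreSym.eq_one_or_neg_one 11 (a := ((2 : ℕ) : ℤ)) (by decide) with h1 | h1
    · rw [h1] at this; revert this; decide
    · exact h1
  rw [hL] at h2
  norm_num at h2

/-- **Values of `ψ = χ↑·(ω²)↑` at level `77`: `ψ(j) = (j/11)·ω(j)²` for every `j`** (units:
`changeLevel_eq_cast_of_dvd'`; non-units: both sides vanish). [cite: KrizLi2019, §2 (p. 11, conventions on characters)] -/
theorem psiD11_apply (hχ : ∀ a : ℕ, χ (a : ZMod 11) = (legendreSym 11 (a : ℤ) : ℚ_[7]))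
    (j : ZMod 77) :
    (changeLevel (by norm_num : 11 ∣ 77) χ * changeLevel (by norm_num : 7 ∣ 77) (ω ^ 2) :
      DirichletCharacter ℚ_[7] 77) j =
      (legendreSym 11 (j.val : ℤ) : ℚ_[7]) * ω (j.val : ZMod 7) ^ 2 := by
  have hj : ((j.val : ℤ) : ZMod 77) = j := by rw [Int.cast_natCast, ZMod.natCast_zmod_val]
  by_cases hu : IsCoprime (j.val : ℤ) (77 : ℕ)
  · conv_lhs => rw [← hj]
    rw [MulChar.mul_apply, changeLevel_eq_cast_of_dvd' _ _ hu, changeLevel_eq_cast_of_dvd' _ _ hu,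
      MulChar.pow_apply' _ two_ne_zero, Int.cast_natCast, Int.cast_natCast, hχ]
  · have hnu : ¬ IsUnit j := by
      rw [← hj, ZMod.coe_int_isUnit_iff_isCoprime]; exact fun h => hu (by simpa [isCoprime_comm] using h)
    rw [MulChar.map_nonunit _ hnu]
    have h77 : ¬ (j.val).Coprime (7 * 11) := fun h => hu (Nat.isCoprime_iff_coprime.mpr h)
    rw [Nat.coprime_mul_iff_right, not_and_or] at h77
    rcases h77 with h7 | h11
    · have hd : 7 ∣ j.val := by
        rwa [Nat.coprime_comm, Nat.Prime.coprime_iff_not_dvd Fact.out, not_not] at h7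
      have h0 : (j.val : ZMod 7) = 0 := (ZMod.natCast_eq_zero_iff _ _).mpr hd
      rw [h0, MulChar.map_zero, zero_pow two_ne_zero, mul_zero]
    · have hd : 11 ∣ j.val := by
        rwa [Nat.coprime_comm, Nat.Prime.coprime_iff_not_dvd Fact.out, not_not] at h11
      have h0 : legendreSym 11 (j.val : ℤ) = 0 :=
        (legendreSym.eq_zero_iff 11 _).mpr (by
          rw [Int.cast_natCast]; exact (ZMod.natCast_eq_zero_iff _ _).mpr hd)
      rw [h0, Int.cast_zero, zero_mul]

/-- **`ψ` is primitive of conductor `77`** (conductors `11` and `7` of `χ_{−11}` and `ω²` are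
coprime and multiply). Hypothesis «`ψ` primitive» of Kriz–Li Thm. 1.20 for `D = −11`.
[cite: KrizLi2019, Thm. 1.20 (p. 7)] [cite: Washington1997, Ch. 3] -/
theorem psiD11_isPrimitive (hω : IsTeichmullerCharacter ω)
    (hχ : ∀ a : ℕ, χ (a : ZMod 11) = (legendreSym 11 (a : ℤ) : ℚ_[7])) :
    (changeLevel (by norm_num : 11 ∣ 77) χ * changeLevel (by norm_num : 7 ∣ 77) (ω ^ 2) :
      DirichletCharacter ℚ_[7] 77).IsPrimitive := by
  rw [isPrimitive_def, conductor_changeLevel_mul_changeLevel _ _ χ (ω ^ 2),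
    conductor_eq_of_prime_of_ne_one χ (legendre11_ne_one χ hχ),
    conductor_eq_of_prime_of_ne_one (ω ^ 2) (teichmuller_sq_ne_one ω hω)]
  rw [conductor_eq_of_prime_of_ne_one χ (legendre11_ne_one χ hχ),
    conductor_eq_of_prime_of_ne_one (ω ^ 2) (teichmuller_sq_ne_one ω hω)]
  decide

/-- **Hypothesis (1a) of Kriz–Li Thm. 1.20 for `D = −11`: `ψ(7) ≠ 1`** (indeed `ψ(7) = 0`, `7 ∣ f`).
[cite: KrizLi2019, Thm. 1.20 (1) (p. 7)] -/
theorem psiD11_apply_seven_ne_one (hχ : ∀ a : ℕ, χ (a : ZMod 11) = (legendreSym 11 (a : ℤ) : ℚ_[7])) :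
    (changeLevel (by norm_num : 11 ∣ 77) χ * changeLevel (by norm_num : 7 ∣ 77) (ω ^ 2) :
      DirichletCharacter ℚ_[7] 77) ((7 : ℕ) : ZMod 77) ≠ 1 := by
  rw [psiD11_apply ω χ hχ]
  have hv : (((7 : ℕ) : ZMod 77)).val = 7 := by rw [ZMod.val_natCast]
  rw [hv, show ((7 : ℕ) : ZMod 7) = 0 by decide, MulChar.map_zero, zero_pow two_ne_zero, mul_zero]
  exact zero_ne_one

/-- `ψ` is odd: `ψ(−1) = (−1/11)·ω(−1)² = −1`. [cite: KrizLi2019, §1.5 (p. 7, ψ₀ = ψε_K for ψ odd)] -/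
theorem psiD11_odd (hχ : ∀ a : ℕ, χ (a : ZMod 11) = (legendreSym 11 (a : ℤ) : ℚ_[7])) :
    (changeLevel (by norm_num : 11 ∣ 77) χ * changeLevel (by norm_num : 7 ∣ 77) (ω ^ 2) :
      DirichletCharacter ℚ_[7] 77).Odd := by
  rw [DirichletCharacter.Odd, show (-1 : ZMod 77) = ((76 : ℕ) : ZMod 77) by decide, psiD11_apply ω χ hχ]
  have hv : (((76 : ℕ) : ZMod 77)).val = 76 := by rw [ZMod.val_natCast]
  have h6 : ((76 : ℕ) : ZMod 7) * ((76 : ℕ) : ZMod 7) = 1 := by decide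
  have hL : legendreSym 11 ((76 : ℕ) : ℤ) = -1 := by
    have := legendreSym.eq_pow 11 ((76 : ℕ) : ℤ)
    rcases legendreSym.eq_one_or_neg_one 11 (a := ((76 : ℕ) : ℤ)) (by decide) with h1 | h1
    · rw [h1] at this; revert this; decide
    · exact h1
  rw [hv, hL, sq, ← map_mul, h6, map_one]
  norm_num

/-- The value of `ω` at `j mod 77` read mod `7` is `ω(j)`. [folklore] -/
theorem natCast_val_zmod77 (ℓ : ℕ) : ((((ℓ : ZMod 77)).val : ℕ) : ZMod 7) = (ℓ : ZMod 7) := by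
  rw [ZMod.val_natCast, ZMod.natCast_eq_natCast_iff', Nat.mod_mod_of_dvd ℓ (by norm_num : 7 ∣ 77)]

/-- `(j mod 77 / 11) = (j/11)`. [folklore] -/
theorem legendreSym_val_zmod77 (ℓ : ℕ) :
    legendreSym 11 ((((ℓ : ZMod 77)).val : ℕ) : ℤ) = legendreSym 11 (ℓ : ℤ) := by
  rw [ZMod.val_natCast, legendreSym.mod 11 (ℓ : ℤ), legendreSym.mod 11 (((ℓ % 77 : ℕ) : ℤ))]
  congr 1
  push_cast
  exact (Int.emod_emod_of_dvd _ (by norm_num : (11 : ℤ) ∣ 77))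

/-- **The `hss` value identity for `D = −11`: `ψ(ℓ) + ψ⁻¹(ℓ)ω(ℓ) = (ℓ/11)·(ω(ℓ)² + ω(ℓ)⁵)` for
`7 ∤ ℓ`, `11 ∤ ℓ`** — the hypothesis `hψ` of `RouteUTraceForm.hss_twist_cm7` (`J(ℓ | 11) = (ℓ/11)`).
[cite: KrizLi2019, Thm. 1.20 and §2 (trace form a_ℓ ≡ ψ(ℓ) + ψ⁻¹ω(ℓ))] -/
theorem psiD11_traceIdentity
    (hχ : ∀ a : ℕ, χ (a : ZMod 11) = (legendreSym 11 (a : ℤ) : ℚ_[7])) (ℓ : ℕ) (h7 : ¬ 7 ∣ ℓ)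
    (h11 : ¬ 11 ∣ ℓ) :
    (changeLevel (by norm_num : 11 ∣ 77) χ * changeLevel (by norm_num : 7 ∣ 77) (ω ^ 2) :
        DirichletCharacter ℚ_[7] 77) (ℓ : ZMod 77) +
      (changeLevel (by norm_num : 11 ∣ 77) χ * changeLevel (by norm_num : 7 ∣ 77) (ω ^ 2) :
        DirichletCharacter ℚ_[7] 77)⁻¹ (ℓ : ZMod 77) * ω (ℓ : ZMod 7) =
      (legendreSym 11 (ℓ : ℤ) : ℚ_[7]) * (ω (ℓ : ZMod 7) ^ 2 + ω (ℓ : ZMod 7) ^ 5) := by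
  set ψ : DirichletCharacter ℚ_[7] 77 :=
    changeLevel (by norm_num : 11 ∣ 77) χ * changeLevel (by norm_num : 7 ∣ 77) (ω ^ 2) with hψdef
  have hψℓ : ψ (ℓ : ZMod 77) = (legendreSym 11 (ℓ : ℤ) : ℚ_[7]) * ω (ℓ : ZMod 7) ^ 2 := by
    rw [hψdef, psiD11_apply ω χ hχ, natCast_val_zmod77, legendreSym_val_zmod77]
  -- `L² = 1`, `ω(ℓ)⁶ = 1`
  have hL2 : ((legendreSym 11 (ℓ : ℤ) : ℚ_[7])) ^ 2 = 1 := by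
    have h0 : ((ℓ : ℤ) : ZMod 11) ≠ 0 := by
      rw [Int.cast_natCast, Ne, ZMod.natCast_eq_zero_iff]; exact h11
    rcases legendreSym.eq_one_or_neg_one 11 h0 with h | h <;> rw [h] <;> norm_num
  have hω6 : ω (ℓ : ZMod 7) ^ 6 = 1 := by
    have := apply_pow_sub_one_eq_one ω (ℓ : ℤ) (by exact_mod_cast h7)
    rwa [Int.cast_natCast] at this
  have hω0 : ω (ℓ : ZMod 7) ≠ 0 := fun h => by rw [h, zero_pow (by norm_num)] at hω6; exact zero_ne_one hω6
  have hinv : ψ⁻¹ (ℓ : ZMod 77) = (legendreSym 11 (ℓ : ℤ) : ℚ_[7]) * ω (ℓ : ZMod 7) ^ 4 := by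
    rw [MulChar.inv_apply_eq_inv', hψℓ]
    apply inv_eq_of_mul_eq_one_right
    linear_combination (ω (ℓ : ZMod 7) ^ 6) * hL2 + hω6
  rw [hψℓ, hinv]
  ring


/-! ## §3 The two Bernoulli characters of Thm. 1.20 for `D = −11`, `K'' = ℚ(√−19)` -/

variable (ε : DirichletCharacter ℚ_[7] 19)

/-- **`bernoulliCharOne ψ ε = (ψ⁻¹)↑`** at level `77·19` (`ψ` is odd, so `ψ₀ = ψε_K` and
`ψ₀⁻¹ε_K = ψ⁻¹`). [cite: KrizLi2019, Thm. 1.20 (p. 8) and §1.5 (ψ₀)] -/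
theorem bernoulliCharOne_psiD11 (hχ : ∀ a : ℕ, χ (a : ZMod 11) = (legendreSym 11 (a : ℤ) : ℚ_[7])) :
    bernoulliCharOne
        (changeLevel (by norm_num : 11 ∣ 77) χ * changeLevel (by norm_num : 7 ∣ 77) (ω ^ 2)) ε =
      changeLevel (dvd_mul_right 77 19)
        (changeLevel (by norm_num : 11 ∣ 77) χ * changeLevel (by norm_num : 7 ∣ 77) (ω ^ 2))⁻¹ := by
  have hodd := psiD11_odd ω χ hχ
  have key : ∀ a b : DirichletCharacter ℚ_[7] (77 * 19), (a * b)⁻¹ * b = a⁻¹ := fun a b => by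
    rw [mul_inv_rev, mul_comm b⁻¹ a⁻¹, inv_mul_cancel_right]
  rw [bernoulliCharOne, evenTwist, if_neg (hodd.not_even), key, map_inv]

/-- **Values of `ψ⁻¹`: `ψ⁻¹(j) = (j/11)·ω(j)⁴`** — the value hypothesis of
`RouteUBernoulliD11.norm_generalizedBernoulli_theta1_D11` (`θ₁ = ψ⁻¹`, primitive of level `77` by
`psiD11_isPrimitive` and `conductor_inv`). [cite: KrizLi2019, Thm. 1.20 (p. 8)] -/
theorem psiD11_inv_apply (hχ : ∀ a : ℕ, χ (a : ZMod 11) = (legendreSym 11 (a : ℤ) : ℚ_[7]))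
    (j : ZMod 77) :
    (changeLevel (by norm_num : 11 ∣ 77) χ * changeLevel (by norm_num : 7 ∣ 77) (ω ^ 2) :
        DirichletCharacter ℚ_[7] 77)⁻¹ j =
      (legendreSym 11 (j.val : ℤ) : ℚ_[7]) * ω (j.val : ZMod 7) ^ 4 := by
  rw [MulChar.inv_apply_eq_inv', psiD11_apply ω χ hχ]
  by_cases h7 : 7 ∣ j.val
  · have h0 : (j.val : ZMod 7) = 0 := (ZMod.natCast_eq_zero_iff _ _).mpr h7
    rw [h0, MulChar.map_zero, zero_pow two_ne_zero, zero_pow (by norm_num), mul_zero, inv_zero]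
  by_cases h11 : 11 ∣ j.val
  · have h0 : legendreSym 11 (j.val : ℤ) = 0 :=
      (legendreSym.eq_zero_iff 11 _).mpr (by rw [Int.cast_natCast]; exact (ZMod.natCast_eq_zero_iff _ _).mpr h11)
    rw [h0, Int.cast_zero, zero_mul, zero_mul, inv_zero]
  have hL2 : ((legendreSym 11 (j.val : ℤ) : ℚ_[7])) ^ 2 = 1 := by
    have h0 : ((j.val : ℤ) : ZMod 11) ≠ 0 := by
      rw [Int.cast_natCast, Ne, ZMod.natCast_eq_zero_iff]; exact h11
    rcases legendreSym.eq_one_or_neg_one 11 h0 with h | h <;> rw [h] <;> norm_num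
  have hω6 : ω (j.val : ZMod 7) ^ 6 = 1 := by
    have := apply_pow_sub_one_eq_one ω (j.val : ℤ) (by exact_mod_cast h7)
    rwa [Int.cast_natCast] at this
  apply inv_eq_of_mul_eq_one_right
  linear_combination (ω (j.val : ZMod 7) ^ 6) * hL2 + hω6

/-- `ψ⁻¹` is primitive of level `77`. [cite: KrizLi2019, Thm. 1.20 (p. 8)] -/
theorem psiD11_inv_isPrimitive (hω : IsTeichmullerCharacter ω)
    (hχ : ∀ a : ℕ, χ (a : ZMod 11) = (legendreSym 11 (a : ℤ) : ℚ_[7])) :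
    (changeLevel (by norm_num : 11 ∣ 77) χ * changeLevel (by norm_num : 7 ∣ 77) (ω ^ 2) :
        DirichletCharacter ℚ_[7] 77)⁻¹.IsPrimitive := by
  rw [isPrimitive_def, conductor_inv]
  exact psiD11_isPrimitive ω χ hω hχ

/-- The Legendre character mod `19` is non-trivial (`(2/19) = −1`). [folklore] -/
theorem legendre19_ne_one (hε : ∀ a : ℕ, ε (a : ZMod 19) = (legendreSym 19 (a : ℤ) : ℚ_[7])) :
    ε ≠ 1 := by
  intro h
  have h2 := hε 2
  rw [h, MulChar.one_apply (by decide)] at h2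
  have hL : legendreSym 19 ((2 : ℕ) : ℤ) = -1 := by
    have := legendreSym.eq_pow 19 ((2 : ℕ) : ℤ)
    rcases legendreSym.eq_one_or_neg_one 19 (a := ((2 : ℕ) : ℤ)) (by decide) with h1 | h1
    · rw [h1] at this; revert this; decide
    · exact h1
  rw [hL] at h2
  norm_num at h2

/-- **`bernoulliCharTwo ψ ε ω = θ₂↑`** with `θ₂ := χ↑·ε↑·ω↑` at level `1463 = 7·11·19`
(`ψ₀ω⁻¹ = χω²εω⁻¹ = χεω`). [cite: KrizLi2019, Thm. 1.20 (p. 8) and §1.5] -/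
theorem bernoulliCharTwo_psiD11 (hχ : ∀ a : ℕ, χ (a : ZMod 11) = (legendreSym 11 (a : ℤ) : ℚ_[7])) :
    bernoulliCharTwo
        (changeLevel (by norm_num : 11 ∣ 77) χ * changeLevel (by norm_num : 7 ∣ 77) (ω ^ 2)) ε ω =
      changeLevel (dvd_mul_right (77 * 19) 7)
        (changeLevel (by norm_num : 11 ∣ 77 * 19) χ * changeLevel (by norm_num : 19 ∣ 77 * 19) ε *
          changeLevel (by norm_num : 7 ∣ 77 * 19) ω) := by
  have hodd := psiD11_odd ω χ hχ
  rw [bernoulliCharTwo, evenTwist, if_neg (hodd.not_even)]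
  simp only [map_mul, map_pow, map_inv, ← changeLevel_trans]
  -- `a · b² · c · b⁻¹ = a · c · b` in the commutative group of characters
  rw [mul_inv_eq_iff_eq_mul, sq, mul_right_comm _ (_ * _) _, mul_assoc (_ * _) _ _]

/-- **Values of `θ₂ = χ↑·ε↑·ω↑`: `θ₂(j) = (j/11)(j/19)·ω(j)`** — the value hypothesis of
`RouteUBernoulliD11.norm_generalizedBernoulli_theta2_D11`. [cite: KrizLi2019, Thm. 1.20 (p. 8)] -/
theorem theta2D11_apply (hχ : ∀ a : ℕ, χ (a : ZMod 11) = (legendreSym 11 (a : ℤ) : ℚ_[7]))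
    (hε : ∀ a : ℕ, ε (a : ZMod 19) = (legendreSym 19 (a : ℤ) : ℚ_[7])) (j : ZMod (77 * 19)) :
    (changeLevel (by norm_num : 11 ∣ 77 * 19) χ * changeLevel (by norm_num : 19 ∣ 77 * 19) ε *
        changeLevel (by norm_num : 7 ∣ 77 * 19) ω : DirichletCharacter ℚ_[7] (77 * 19)) j =
      ((legendreSym 11 (j.val : ℤ) * legendreSym 19 (j.val : ℤ) : ℤ) : ℚ_[7]) *
        ω (j.val : ZMod 7) ^ 1 := by
  have hj : ((j.val : ℤ) : ZMod (77 * 19)) = j := by rw [Int.cast_natCast, ZMod.natCast_zmod_val]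
  by_cases hu : IsCoprime (j.val : ℤ) ((77 * 19 : ℕ) : ℤ)
  · conv_lhs => rw [← hj]
    rw [MulChar.mul_apply, MulChar.mul_apply, changeLevel_eq_cast_of_dvd' _ _ hu,
      changeLevel_eq_cast_of_dvd' _ _ hu, changeLevel_eq_cast_of_dvd' _ _ hu, Int.cast_natCast,
      Int.cast_natCast, Int.cast_natCast, hχ, hε, pow_one, Int.cast_mul]
  · have hnu : ¬ IsUnit j := by
      rw [← hj, ZMod.coe_int_isUnit_iff_isCoprime]; exact fun h => hu (by simpa [isCoprime_comm] using h)
    rw [MulChar.map_nonunit _ hnu]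
    have h3 : ¬ (j.val).Coprime (7 * (11 * 19)) := fun h => hu (Nat.isCoprime_iff_coprime.mpr h)
    rw [Nat.coprime_mul_iff_right, Nat.coprime_mul_iff_right, not_and_or, not_and_or] at h3
    rcases h3 with h7 | h11 | h19
    · have hd : 7 ∣ j.val := by
        rwa [Nat.coprime_comm, Nat.Prime.coprime_iff_not_dvd Fact.out, not_not] at h7
      rw [(ZMod.natCast_eq_zero_iff _ _).mpr hd, MulChar.map_zero, pow_one, mul_zero]
    · have hd : 11 ∣ j.val := by
        rwa [Nat.coprime_comm, Nat.Prime.coprime_iff_not_dvd Fact.out, not_not] at h11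
      have h0 : legendreSym 11 (j.val : ℤ) = 0 :=
        (legendreSym.eq_zero_iff 11 _).mpr (by rw [Int.cast_natCast]; exact (ZMod.natCast_eq_zero_iff _ _).mpr hd)
      rw [h0, zero_mul, Int.cast_zero, zero_mul]
    · have hd : 19 ∣ j.val := by
        rwa [Nat.coprime_comm, Nat.Prime.coprime_iff_not_dvd Fact.out, not_not] at h19
      have h0 : legendreSym 19 (j.val : ℤ) = 0 :=
        (legendreSym.eq_zero_iff 19 _).mpr (by rw [Int.cast_natCast]; exact (ZMod.natCast_eq_zero_iff _ _).mpr hd)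
      rw [h0, mul_zero, Int.cast_zero, zero_mul]

/-- **`θ₂` is primitive of level `1463`** (conductors `11`, `19`, `7` pairwise coprime).
[cite: KrizLi2019, Thm. 1.20 (p. 8)] [cite: Washington1997, Ch. 3] -/
theorem theta2D11_isPrimitive (hω : IsTeichmullerCharacter ω)
    (hχ : ∀ a : ℕ, χ (a : ZMod 11) = (legendreSym 11 (a : ℤ) : ℚ_[7]))
    (hε : ∀ a : ℕ, ε (a : ZMod 19) = (legendreSym 19 (a : ℤ) : ℚ_[7])) :
    (changeLevel (by norm_num : 11 ∣ 77 * 19) χ * changeLevel (by norm_num : 19 ∣ 77 * 19) ε *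
        changeLevel (by norm_num : 7 ∣ 77 * 19) ω : DirichletCharacter ℚ_[7] (77 * 19)).IsPrimitive := by
  have hc11 := conductor_eq_of_prime_of_ne_one χ (legendre11_ne_one χ hχ)
  have hc19 := conductor_eq_of_prime_of_ne_one ε (legendre19_ne_one ε hε)
  have hω1 : ω ≠ 1 := fun h => teichmuller_sq_ne_one ω hω (by rw [h, one_pow])
  have hc7 := conductor_eq_of_prime_of_ne_one ω hω1
  have h1 : (changeLevel (by norm_num : 11 ∣ 77 * 19) χ * changeLevel (by norm_num : 19 ∣ 77 * 19) ε :
      DirichletCharacter ℚ_[7] (77 * 19)).conductor = 11 * 19 := by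
    rw [conductor_changeLevel_mul_changeLevel _ _ χ ε (by rw [hc11, hc19]; decide), hc11, hc19]
  rw [isPrimitive_def, conductor_mul_eq_mul_of_coprime _ _ (by rw [h1, conductor_changeLevel, hc7]; decide),
    h1, conductor_changeLevel, hc7]


end Psi

/-- **The Legendre character mod an odd prime `q` as a `ℚ₇`-valued Dirichlet character exists**
(Mathlib's `quadraticChar (ZMod q)` composed with `ℤ → ℚ₇`), so the hypotheses `hχ`, `hε` above
are instantiable (`q = 11, 19`). [folklore] -/
theorem exists_legendreCharacter (q : ℕ) [Fact q.Prime] :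
    ∃ χ : DirichletCharacter ℚ_[7] q, ∀ a : ℕ, χ (a : ZMod q) = (legendreSym q (a : ℤ) : ℚ_[7]) :=
  ⟨(quadraticChar (ZMod q)).ringHomComp (Int.castRingHom ℚ_[7]), fun a => by
    rw [MulChar.ringHomComp_apply, legendreSym, Int.cast_natCast]; rfl⟩


end Summit.BirchSwinnertonDyer.Rank1Residual.X12.O11.RouteU

end
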